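import Mathlib.Data.Real.Basic
import Mathlib.Tactic
import HarnessLib

/-!
# QUANT lane R8, T-DEC, leg (III), blob case — cell B-TWIN of `LawDec.GatedSliceMixLaw'`: the REAL INEQUALITIES behind the corrected
# leaf (E) of `LawDec.mixLawCellBTwin_of_E` (pure real algebra, no law objects)

builds on p205010 (kernel theorem, internal audit signed; external expert review pending)

Support file (`--supports stmt-CriticalPhenomena-4575`), QUANT lane LEAD seat prim-quant-lead (gen 34), rung R8 of
`run/shared/lean/prim/quant/LADDER.md`.  Memo `run/shared/lean/prim/quant/prim-quant-lead-g34/FOR-PROVERS-BTWIN-E.md`.  Theorems only,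
standard axioms, no sorries, no definitions; imports Mathlib only (the assembly `…QuantGatedSliceMixLawRegimeBTwinHolds` instantiates them).

NOTATION (cell B-TWIN of `GatedSliceMixLaw'`; see `…QuantGatedSliceMixLawRegimeBCells`).  `u = y/(1−y)`; `ν = (1−z)(1−λ)`, `Λ = (1−z)λ`
(so `ν(K−k₁) = (1−z)K − S`, `Λ(K−k₁) = S − (1−z)k₁` by the mean identity, `K = k₂`); `t = S + A₀`, `A₀ = ag(1−z)`, `d = t − 2k₁`;
`X = h − k₁`; the overflow of the greedy twin fill is `o = ν·w` with `w = 1 − g` (twin incompatible) or `w = (d − ag)/d` (twin compatible,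
not filled); `Q = (h − S) − g(K − S)`, `R = (S − k₁)(1 − g)`.  THE PROOF OF (E) (lead g34, exact-engine guided; every step 0-exception on
≥ 10⁵ exact instances before it was written down):
* (A) `btwinE_leafA`: `k₁ ≤ S(1 − w)` ⟹ the `θ = 0` routing `u(o + z) ≤ Λ` (affine in `y`, checked at the top-affordability corner `yK = S`,
  where it is the identity `(K−S)(S−(1−z)k₁) − Sz(K−k₁) = (S−k₁)((1−z)K−S)`).
* (F1) `btwinE_F1_incomp` / `btwinE_F1_comp`: `k₁ > S(1 − w)` ⟹ `k₁ ≥ A₀` (so `t ≤ S + k₁ < h + k₁`: `W_h`'s mid is compatible).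
* (corner) `btwinE_corner`: criterion E ⟸ the corner form `U·w·Q ≤ R` (again affine in `y`, corner `yK = S`).
* (heavy) `btwinE_heavy`: `U = d/(X − d)` and `d·w·(h − S) ≤ (S − k₁)(X − d)` ⟹ `U·w·Q ≤ R` (`Q ≤ (1−g)(h−S)` as `K ≥ h`); the hypothesis
  by `btwinE_heavy_incomp` (`= X(k₁−A₀) + dg(h−S) ≥ 0`) / `btwinE_heavy_comp` (`= (h−S)(k₁+agz) + (S−k₁)(k₁−A₀) ≥ 0`).
* (light) `U = γ/(1−γ)`, `γ = y² + (1−y)d/X`: `btwinE_light_core` reduces `U·w·Q ≤ R` to `Φ(yX) ≥ 0` for the concave quadratic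
  `Φ(s) = (S−k₁)(1−y)(s(1+y) − yd) − w(ys + (1−y)d)(s − y(S−k₁))`; `btwinE_light_concave` (endpoints suffice), `btwinE_light_end_d` /
  `btwinE_light_end_low` (left endpoints `s = d`, `s = y(S−k₁)`), `btwinE_light_end_top` (right endpoint `s = S − yk₁`, i.e. `yh = S`:
  `Φ = (1−y)[(S−k₁)(k₁(2−y) − A₀) − (k₁ − S(1−w))(yS − y²k₁ + (1−y)d)]`, decreasing in `A₀ ≤ k₁`, and at `A₀ = k₁` it is
  `(S−k₁)(Sg − yk₁) − (k₁−Sg)yk₁(1−y) ≥ g(S−k₁)² − gk₁² ≥ 0` by `y ≤ g`, `2k₁ ≤ S`).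
HONEST STATUS: `MixLawCellBTwin` OPEN until the assembly lands; `MixLawRegimeB`, `GatedSliceMixLaw'`, CW, `GateMove`, `SingleGateConvClosed`,
`TreeDEC`, `FarTreeRow` OPEN; RATE class log* / honest sentence unchanged.

[this work].  Nothing here is cited as a published result.  The gluing rows served [cite: KozmaNitzan2024, Conjecture 3 (p. 15)];
product measure [cite: Grimmett1999, §1.3 p. 10].
-/

namespace Summit.CriticalPhenomena.PercolationContinuityZ3.Theorems

namespace Quant

namespace LawDec

/-! ### (A) the `θ = 0` routing when `k₁ ≤ S(1 − w)` -/

/-- **Leaf (A).**  `k₁ ≤ S(1−w)` ⟹ `u·(ν w + z) ≤ Λ` on the frame (`yK ≤ S`, `k₁ < K`, `(1−z)k₁ ≤ S ≤ (1−z)K`, `w ≥ 0`).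
Certificate: `K(K−k₁)((1−y)Λ − y(νw+z)) = ((1−z)K−S)(S(1−w) − k₁) + (S − yK)(S − (1−z)k₁ + ((1−z)K−S)w + z(K−k₁))`. [this work] -/
theorem btwinE_leafA (y z S w ν Λ K k₁ : ℝ) (hy1 : y < 1) (hz0 : 0 ≤ z) (hyK : y * K ≤ S)
    (hk0 : 0 ≤ k₁) (hKk : k₁ < K) (hw0 : 0 ≤ w)
    (hν : ν * (K - k₁) = (1 - z) * K - S) (hΛ : Λ * (K - k₁) = S - (1 - z) * k₁)
    (hνK : 0 ≤ (1 - z) * K - S) (hSk : (1 - z) * k₁ ≤ S) (hA : k₁ ≤ S * (1 - w)) :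
    y / (1 - y) * (ν * w + z) ≤ Λ := by
  have h1y : 0 < 1 - y := by linarith
  have hK0 : 0 < K := by linarith
  have hKk' : 0 < K - k₁ := by linarith
  rw [div_mul_eq_mul_div, div_le_iff₀ h1y]
  -- `y (νw + z) ≤ Λ (1 - y)`
  have key : K * (K - k₁) * ((1 - y) * Λ - y * (ν * w + z))
      = ((1 - z) * K - S) * (S * (1 - w) - k₁) + (S - y * K) * (S - (1 - z) * k₁ + ((1 - z) * K - S) * w + z * (K - k₁)) := by
    linear_combination (K * (1 - y)) * hΛ - (K * y * w) * hν
  have h1 : 0 ≤ ((1 - z) * K - S) * (S * (1 - w) - k₁) := mul_nonneg hνK (by linarith)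
  have h2 : 0 ≤ (S - y * K) * (S - (1 - z) * k₁ + ((1 - z) * K - S) * w + z * (K - k₁)) :=
    mul_nonneg (by linarith) (add_nonneg (add_nonneg (by linarith) (mul_nonneg hνK hw0)) (mul_nonneg hz0 hKk'.le))
  have hprod : 0 ≤ K * (K - k₁) * ((1 - y) * Λ - y * (ν * w + z)) := by rw [key]; exact add_nonneg h1 h2
  have hpos : 0 < K * (K - k₁) := mul_pos hK0 hKk'
  have : 0 ≤ (1 - y) * Λ - y * (ν * w + z) := by
    by_contra hneg
    push Not at hneg
    have := mul_neg_of_pos_of_neg hpos hneg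
    linarith
  linarith

/-! ### (F1) in the other region the low `k₁` is at least the blob mean `A₀ = ag(1−z)` -/

/-- **(F1), twin incompatible** (`a(1 − g(1−z)) ≤ S − 2k₁`, i.e. `t ≥ 2k₁ + a`): `Sg ≤ k₁` ⟹ `ag(1−z) ≤ k₁`.
(`(1−G)(k₁ − A₀) ≥ (k₁ − Sg) + Gk₁ + S(g − G)`, `G = g(1−z)`.) [this work] -/
theorem btwinE_F1_incomp (z g S a k₁ : ℝ) (hz0 : 0 ≤ z) (hz1 : z ≤ 1) (hg0 : 0 ≤ g) (hg1 : g < 1) (hS0 : 0 ≤ S)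
    (hk0 : 0 ≤ k₁) (hinc : a * (1 - g * (1 - z)) ≤ S - 2 * k₁) (hSg : S * g ≤ k₁) :
    a * g * (1 - z) ≤ k₁ := by
  have hG0 : 0 ≤ g * (1 - z) := mul_nonneg hg0 (by linarith)
  have hGg : g * (1 - z) ≤ g := by nlinarith
  have hG1 : g * (1 - z) < 1 := lt_of_le_of_lt hGg hg1
  have h1 := mul_le_mul_of_nonneg_left hinc hG0
  -- (1 - G)(k₁ - A₀) ≥ (k₁ - Sg) + G k₁ + S (g - G) ≥ 0
  have key : 0 ≤ (1 - g * (1 - z)) * (k₁ - a * g * (1 - z)) := by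
    nlinarith [mul_nonneg hG0 hk0, mul_nonneg hS0 (sub_nonneg.2 hGg)]
  by_contra hlt
  push Not at hlt
  have : (1 - g * (1 - z)) * (k₁ - a * g * (1 - z)) < 0 := mul_neg_of_pos_of_neg (by linarith) (by linarith)
  linarith

/-- **(F1), twin compatible and not filled** (`k₁·d > S·ag`, `d = S + A₀ − 2k₁`, `A₀ = ag(1−z) ≤ S`): `A₀ ≤ k₁`
(if `k₁ < A₀` then `k₁d − S·A₀ = (k₁−A₀)S + k₁(A₀−2k₁) ≤ −(A₀−k₁)² − k₁² < 0`). [this work] -/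
theorem btwinE_F1_comp (z g S a k₁ : ℝ) (hz0 : 0 ≤ z) (hz1 : z ≤ 1) (hg0 : 0 ≤ g) (ha0 : 0 ≤ a)
    (hA0S : a * g * (1 - z) ≤ S) (hreg : S * (a * g) < k₁ * (S + a * g * (1 - z) - 2 * k₁)) :
    a * g * (1 - z) ≤ k₁ := by
  set A₀ := a * g * (1 - z) with hA₀
  have hA0 : 0 ≤ A₀ := mul_nonneg (mul_nonneg ha0 hg0) (by linarith)
  have hAag : A₀ ≤ a * g := by rw [hA₀]; nlinarith [mul_nonneg ha0 hg0]
  have hS0 : 0 ≤ S := le_trans hA0 hA0S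
  have h1 : S * A₀ ≤ S * (a * g) := mul_le_mul_of_nonneg_left hAag hS0
  by_contra hlt
  push Not at hlt
  -- k₁ d - S A₀ ≤ (k₁ - A₀) A₀ + k₁ (A₀ - 2 k₁) = -((A₀-k₁)^2 + k₁^2)
  nlinarith [mul_nonneg hS0 hA0, sq_nonneg (A₀ - k₁), sq_nonneg k₁,
    mul_le_mul_of_nonneg_left hA0S (by linarith : (0:ℝ) ≤ A₀ - k₁)]

/-! ### (corner) criterion E from its corner form -/

/-- **Criterion E ⟸ the corner form `U·w·Q ≤ R`.**  Both sides of criterion E are affine in `y` (LHS increasing, RHS decreasing); at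
the corner `yK = S` it is `S((1−z)K−S)·(R − UwQ) ≥ 0`:
`K(K−k₁)·N = S((1−z)K−S)(R − UwQ) + (S − yK)·[S(1−g)((S−(1−z)k₁) + z(K−k₁)) + Uw((1−z)K−S)((h−S) + Sg)]`,
`N = S(1−g)((1−y)Λ − yz) − Uνw(y(h−S) − (1−y)Sg) = h(1−y)·(RHS − LHS)`. [this work] -/
theorem btwinE_corner (y z g S ν Λ U w K k₁ h : ℝ) (hy1 : y < 1) (hz0 : 0 ≤ z) (hg0 : 0 ≤ g) (hg1 : g ≤ 1)
    (hyK : y * K ≤ S) (hk0 : 0 ≤ k₁) (hKk : k₁ < K) (hS0 : 0 < S) (hh : S < h) (hU0 : 0 ≤ U) (hw0 : 0 ≤ w)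
    (hν : ν * (K - k₁) = (1 - z) * K - S) (hΛ : Λ * (K - k₁) = S - (1 - z) * k₁)
    (hνK : 0 ≤ (1 - z) * K - S) (hSk : (1 - z) * k₁ ≤ S)
    (hBc : U * w * ((h - S) - g * (K - S)) ≤ (S - k₁) * (1 - g)) :
    U * (ν * w) * (y / (1 - y) * (1 - S / h) - S / h * g) ≤ S / h * (1 - g) * (Λ - y / (1 - y) * z) := by
  have h1y : 0 < 1 - y := by linarith
  have hh0 : 0 < h := lt_trans hS0 hh
  have hK0 : 0 < K := by linarith
  have hKk' : 0 < K - k₁ := by linarith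
  -- numerator form
  have key : K * (K - k₁) * (S * (1 - g) * ((1 - y) * Λ - y * z) - U * ν * w * (y * (h - S) - (1 - y) * S * g))
      = S * ((1 - z) * K - S) * ((S - k₁) * (1 - g) - U * w * ((h - S) - g * (K - S)))
        + (S - y * K) * (S * (1 - g) * ((S - (1 - z) * k₁) + z * (K - k₁)) + U * w * ((1 - z) * K - S) * ((h - S) + S * g)) := by
    linear_combination (K * S * (1 - g) * (1 - y)) * hΛ - (K * U * w * (y * (h - S) - (1 - y) * S * g)) * hν
  have hUw : 0 ≤ U * w := mul_nonneg hU0 hw0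
  have h1 : 0 ≤ S * ((1 - z) * K - S) * ((S - k₁) * (1 - g) - U * w * ((h - S) - g * (K - S))) :=
    mul_nonneg (mul_nonneg hS0.le hνK) (by linarith)
  have h2 : 0 ≤ (S - y * K) * (S * (1 - g) * ((S - (1 - z) * k₁) + z * (K - k₁))
      + U * w * ((1 - z) * K - S) * ((h - S) + S * g)) := by
    refine mul_nonneg (by linarith) (add_nonneg ?_ ?_)
    · exact mul_nonneg (mul_nonneg hS0.le (by linarith)) (add_nonneg (by linarith) (mul_nonneg hz0 hKk'.le))
    · exact mul_nonneg (mul_nonneg hUw hνK) (add_nonneg (by linarith) (mul_nonneg hS0.le hg0))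
  have hprod : 0 ≤ K * (K - k₁) * (S * (1 - g) * ((1 - y) * Λ - y * z) - U * ν * w * (y * (h - S) - (1 - y) * S * g)) := by
    rw [key]; exact add_nonneg h1 h2
  have hN : 0 ≤ S * (1 - g) * ((1 - y) * Λ - y * z) - U * ν * w * (y * (h - S) - (1 - y) * S * g) := by
    by_contra hneg
    push Not at hneg
    have := mul_neg_of_pos_of_neg (mul_pos hK0 hKk') hneg
    linarith
  -- back to the divided form
  have hL : U * (ν * w) * (y / (1 - y) * (1 - S / h) - S / h * g)
      = (U * ν * w * (y * (h - S) - (1 - y) * S * g)) / ((1 - y) * h) := by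
    field_simp
  have hR : S / h * (1 - g) * (Λ - y / (1 - y) * z) = (S * (1 - g) * ((1 - y) * Λ - y * z)) / ((1 - y) * h) := by
    field_simp
  rw [hL, hR, div_le_div_iff_of_pos_right (mul_pos h1y hh0)]
  linarith

/-! ### (heavy) `k₁` heavy at `h`: `U = d/(X − d)` -/

/-- **Heavy leaf.**  `U = d/(X−d)` with `d < X = h − k₁`, `K ≥ h > S > k₁`, `g ≤ 1`, `w ≥ 0`, and the core inequality
`d·w·(h − S) ≤ (S − k₁)(X − d)` ⟹ `U·w·((h−S) − g(K−S)) ≤ (S−k₁)(1−g)` (`Q ≤ (1−g)(h−S)` since `K ≥ h`). [this work] -/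
theorem btwinE_heavy (g S d U w K k₁ h : ℝ) (hg0 : 0 ≤ g) (hg1 : g ≤ 1) (hKh : h ≤ K)
    (hd0 : 0 < d) (hdX : d < h - k₁) (hw0 : 0 ≤ w) (hU : U = d / (h - k₁ - d))
    (hcore : d * w * (h - S) ≤ (S - k₁) * (h - k₁ - d)) :
    U * w * ((h - S) - g * (K - S)) ≤ (S - k₁) * (1 - g) := by
  have hXd : 0 < h - k₁ - d := by linarith
  have hU0 : 0 ≤ U := by rw [hU]; exact div_nonneg hd0.le hXd.le
  have hQ : (h - S) - g * (K - S) ≤ (1 - g) * (h - S) := by nlinarith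
  have hdiv : d * w * (h - S) / (h - k₁ - d) ≤ S - k₁ := by
    rw [div_le_iff₀ hXd]; exact hcore
  calc U * w * ((h - S) - g * (K - S)) ≤ U * w * ((1 - g) * (h - S)) :=
        mul_le_mul_of_nonneg_left hQ (mul_nonneg hU0 hw0)
    _ = (1 - g) * (d * w * (h - S) / (h - k₁ - d)) := by rw [hU]; field_simp
    _ ≤ (1 - g) * (S - k₁) := mul_le_mul_of_nonneg_left hdiv (by linarith)
    _ = (S - k₁) * (1 - g) := by ring

/-- **the core inequality, twin incompatible** (`w = 1 − g`, `d = S + A₀ − 2k₁`, `A₀ ≤ k₁`):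
`(S−k₁)(X−d) − d(1−g)(h−S) = X(k₁ − A₀) + dg(h − S) ≥ 0`. [this work] -/
theorem btwinE_heavy_incomp (g S d A₀ k₁ h : ℝ) (hg0 : 0 ≤ g) (hh : S < h) (hA : A₀ ≤ k₁)
    (hd : d = S + A₀ - 2 * k₁) (hd0 : 0 ≤ d) :
    d * (1 - g) * (h - S) ≤ (S - k₁) * (h - k₁ - d) := by
  have key : (S - k₁) * (h - k₁ - d) - d * (1 - g) * (h - S) = (h - k₁) * (k₁ - A₀) + d * g * (h - S) := by
    rw [hd]; ring
  nlinarith [mul_nonneg (show (0:ℝ) ≤ h - k₁ by linarith) (show (0:ℝ) ≤ k₁ - A₀ by linarith),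
    mul_nonneg (mul_nonneg hd0 hg0) (show (0:ℝ) ≤ h - S by linarith)]

/-- **the core inequality, twin compatible and not filled** (`d·w = d − ag`, `d = S + ag(1−z) − 2k₁`, `ag(1−z) ≤ k₁ ≤ S`):
`(S−k₁)(X−d) − (d−ag)(h−S) = (h−S)(k₁ + agz) + (S−k₁)(k₁ − ag(1−z)) ≥ 0`. [this work] -/
theorem btwinE_heavy_comp (z g S d a w k₁ h : ℝ) (hz0 : 0 ≤ z) (hg0 : 0 ≤ g) (ha0 : 0 ≤ a) (hh : S < h) (hSk : k₁ ≤ S)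
    (hk0 : 0 ≤ k₁) (hA : a * g * (1 - z) ≤ k₁) (hd : d = S + a * g * (1 - z) - 2 * k₁) (hdw : d * w = d - a * g) :
    d * w * (h - S) ≤ (S - k₁) * (h - k₁ - d) := by
  rw [hdw]
  have key : (S - k₁) * (h - k₁ - d) - (d - a * g) * (h - S)
      = (h - S) * (k₁ + a * g * z) + (S - k₁) * (k₁ - a * g * (1 - z)) := by
    rw [hd]; ring
  nlinarith [mul_nonneg (show (0:ℝ) ≤ h - S by linarith) (add_nonneg hk0 (mul_nonneg (mul_nonneg ha0 hg0) hz0)),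
    mul_nonneg (show (0:ℝ) ≤ S - k₁ by linarith) (show (0:ℝ) ≤ k₁ - a * g * (1 - z) by linarith)]

/-! ### (light) `k₁` light at `h`: `U = γ/(1−γ)`, `γ = y² + (1−y)d/X` -/

/-- **Light leaf, core reduction.**  With `X = h − k₁`, `d < yX`, `U = γ/(1−γ)`, `γ = y² + (1−y)d/X`, `K ≥ h > S > k₁`,
`g < 1`, `w ≥ 0`: `Φ(yX) ≥ 0` ⟹ `U·w·((h−S) − g(K−S)) ≤ (S−k₁)(1−g)`, where
`Φ(s) = (S−k₁)(1−y)(s(1+y) − yd) − w(ys + (1−y)d)(s − y(S−k₁))`. [this work] -/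
theorem btwinE_light_core (y g S d U w K k₁ h : ℝ) (hy0 : 0 < y) (hy1 : y < 1) (hg0 : 0 ≤ g) (hg1 : g < 1) (hSk : k₁ < S)
    (hh : S < h) (hKh : h ≤ K) (hd0 : 0 < d) (hdX : d < y * (h - k₁)) (hw0 : 0 ≤ w)
    (hU : U = (y ^ 2 * (h - k₁) + (1 - y) * d) / ((1 - y) * ((1 - y) * k₁ + (1 + y) * h - (d + 2 * k₁))))
    (hΦ : 0 ≤ (S - k₁) * (1 - y) * (y * (h - k₁) * (1 + y) - y * d)
            - w * (y * (y * (h - k₁)) + (1 - y) * d) * (y * (h - k₁) - y * (S - k₁))) :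
    U * w * ((h - S) - g * (K - S)) ≤ (S - k₁) * (1 - g) := by
  have hX : 0 < h - k₁ := by linarith
  have h1y : 0 < 1 - y := by linarith
  obtain ⟨γ, hγ⟩ : ∃ q : ℝ, q = y ^ 2 + (1 - y) * (d / (h - k₁)) := ⟨_, rfl⟩
  have hρ0 : 0 < d / (h - k₁) := div_pos hd0 hX
  have hρ1 : d / (h - k₁) < y := by rw [div_lt_iff₀ hX]; linarith
  have hγ0 : 0 < γ := by rw [hγ]; positivity
  have hγy : γ < y := by rw [hγ]; nlinarith [mul_lt_mul_of_pos_left hρ1 h1y]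
  have hγ1 : γ < 1 := by linarith
  have h1γ : 0 < 1 - γ := by linarith
  -- the closed form is γ/(1-γ)
  have hden : (1 - y) * ((1 - y) * k₁ + (1 + y) * h - (d + 2 * k₁)) = (1 - γ) * (h - k₁) := by
    rw [hγ]; field_simp; ring
  have hnum : y ^ 2 * (h - k₁) + (1 - y) * d = γ * (h - k₁) := by
    rw [hγ]; field_simp
  replace hU : U = γ / (1 - γ) := by
    rw [hU, hden, hnum, mul_div_mul_right _ _ hX.ne']
  have hU0 : 0 ≤ U := by rw [hU]; exact div_nonneg hγ0.le h1γ.le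
  have hQ : (h - S) - g * (K - S) ≤ (1 - g) * (h - S) := by nlinarith
  -- γ X = y (yX) + (1 - y) d
  have hγX : γ * (h - k₁) = y * (y * (h - k₁)) + (1 - y) * d := by
    rw [hγ]; field_simp
  -- the reduction: γ (w (h - S) + (S - k₁)) ≤ S - k₁
  have hmain : γ * (w * (h - S) + (S - k₁)) ≤ S - k₁ := by
    -- Φ ≥ 0 ⟺ (ys + (1-y)d)(w(s - y(S-k₁)) + y(S-k₁)) ≤ (S-k₁) s, s = yX
    have h2 : (y * (y * (h - k₁)) + (1 - y) * d) * (w * (y * (h - k₁) - y * (S - k₁)) + y * (S - k₁))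
        ≤ (S - k₁) * (y * (h - k₁)) := by nlinarith
    -- substitute γX and factor y: (γX) · y · (w(h-S) + (S-k₁)) ≤ (S-k₁) y X
    have h3 : (γ * (h - k₁)) * (y * (w * (h - S) + (S - k₁))) ≤ (S - k₁) * (y * (h - k₁)) := by
      rw [hγX]
      have e : w * (y * (h - k₁) - y * (S - k₁)) + y * (S - k₁) = y * (w * (h - S) + (S - k₁)) := by ring
      rw [← e]; exact h2
    -- cancel y X > 0
    have h4 : (γ * (w * (h - S) + (S - k₁))) * (y * (h - k₁)) ≤ (S - k₁) * (y * (h - k₁)) := by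
      have e : (γ * (h - k₁)) * (y * (w * (h - S) + (S - k₁))) = (γ * (w * (h - S) + (S - k₁))) * (y * (h - k₁)) := by ring
      rw [← e]; exact h3
    exact le_of_mul_le_mul_right h4 (mul_pos hy0 hX)
  have hdiv : γ * (w * (h - S)) / (1 - γ) ≤ S - k₁ := by
    rw [div_le_iff₀ h1γ]; nlinarith [hmain]
  calc U * w * ((h - S) - g * (K - S)) ≤ U * w * ((1 - g) * (h - S)) := mul_le_mul_of_nonneg_left hQ (mul_nonneg hU0 hw0)
    _ = (1 - g) * (γ * (w * (h - S)) / (1 - γ)) := by rw [hU]; ring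
    _ ≤ (1 - g) * (S - k₁) := mul_le_mul_of_nonneg_left hdiv (by linarith)
    _ = (S - k₁) * (1 - g) := by ring

/-- **the endpoints suffice** for the concave quadratic `Φ` (leading coefficient `−wy ≤ 0`):
`(q−p)Φ(s) = (q−s)Φ(p) + (s−p)Φ(q) + wy(s−p)(q−s)(q−p)`. [this work] -/
theorem btwinE_light_concave (y S d w k₁ p q s : ℝ) (hy0 : 0 ≤ y) (hw0 : 0 ≤ w) (hps : p ≤ s) (hsq : s ≤ q)
    (hp : 0 ≤ (S - k₁) * (1 - y) * (p * (1 + y) - y * d) - w * (y * p + (1 - y) * d) * (p - y * (S - k₁)))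
    (hq : 0 ≤ (S - k₁) * (1 - y) * (q * (1 + y) - y * d) - w * (y * q + (1 - y) * d) * (q - y * (S - k₁))) :
    0 ≤ (S - k₁) * (1 - y) * (s * (1 + y) - y * d) - w * (y * s + (1 - y) * d) * (s - y * (S - k₁)) := by
  rcases eq_or_lt_of_le (le_trans hps hsq) with hpq | hpq
  · have hsp : s = p := le_antisymm (hpq ▸ hsq) hps
    rw [hsp]; exact hp
  · have key : (q - p) * ((S - k₁) * (1 - y) * (s * (1 + y) - y * d) - w * (y * s + (1 - y) * d) * (s - y * (S - k₁)))
        = (q - s) * ((S - k₁) * (1 - y) * (p * (1 + y) - y * d) - w * (y * p + (1 - y) * d) * (p - y * (S - k₁)))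
          + (s - p) * ((S - k₁) * (1 - y) * (q * (1 + y) - y * d) - w * (y * q + (1 - y) * d) * (q - y * (S - k₁)))
          + w * y * (s - p) * (q - s) * (q - p) := by ring
    have h3 : 0 ≤ w * y * (s - p) * (q - s) * (q - p) :=
      mul_nonneg (mul_nonneg (mul_nonneg (mul_nonneg hw0 hy0) (by linarith)) (by linarith)) (by linarith)
    have hprod : 0 ≤ (q - p) * ((S - k₁) * (1 - y) * (s * (1 + y) - y * d)
        - w * (y * s + (1 - y) * d) * (s - y * (S - k₁))) := by
      rw [key]
      exact add_nonneg (add_nonneg (mul_nonneg (by linarith) hp) (mul_nonneg (by linarith) hq)) h3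
    by_contra hneg
    push Not at hneg
    have := mul_neg_of_pos_of_neg (show (0:ℝ) < q - p by linarith) hneg
    linarith

/-- **left endpoint `s = d`**: `Φ(d) = d·[(S−k₁)(1−y) − w(d − y(S−k₁))] ≥ 0` from `dw ≤ (S−k₁)(1−g)` (i.e. `c_X ≥ 0`), `y ≤ g`,
`0 ≤ w ≤ 1`. [this work] -/
theorem btwinE_light_end_d (y g S d w k₁ : ℝ) (hy0 : 0 ≤ y) (hyg : y ≤ g) (hSk : k₁ ≤ S) (hd0 : 0 ≤ d) (hw0 : 0 ≤ w)
    (hcX : d * w ≤ (S - k₁) * (1 - g)) :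
    0 ≤ (S - k₁) * (1 - y) * (d * (1 + y) - y * d) - w * (y * d + (1 - y) * d) * (d - y * (S - k₁)) := by
  have key : (S - k₁) * (1 - y) * (d * (1 + y) - y * d) - w * (y * d + (1 - y) * d) * (d - y * (S - k₁))
      = d * ((S - k₁) * (1 - y) - w * (d - y * (S - k₁))) := by ring
  rw [key]
  refine mul_nonneg hd0 ?_
  nlinarith [mul_nonneg hy0 (show (0:ℝ) ≤ S - k₁ by linarith), mul_nonneg hy0 hw0,
    mul_nonneg (mul_nonneg hy0 hw0) (show (0:ℝ) ≤ S - k₁ by linarith),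
    mul_nonneg (sub_nonneg.2 hyg) (show (0:ℝ) ≤ S - k₁ by linarith)]

/-- **left endpoint `s = y(S−k₁)`** (when `d ≤ y(S−k₁)`): `Φ = (S−k₁)(1−y)·y·((S−k₁)(1+y) − d) ≥ 0`. [this work] -/
theorem btwinE_light_end_low (y S d w k₁ : ℝ) (hy0 : 0 ≤ y) (hy1 : y ≤ 1) (hSk : k₁ ≤ S) (hd : d ≤ y * (S - k₁)) :
    0 ≤ (S - k₁) * (1 - y) * (y * (S - k₁) * (1 + y) - y * d)
        - w * (y * (y * (S - k₁)) + (1 - y) * d) * (y * (S - k₁) - y * (S - k₁)) := by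
  have key : (S - k₁) * (1 - y) * (y * (S - k₁) * (1 + y) - y * d)
        - w * (y * (y * (S - k₁)) + (1 - y) * d) * (y * (S - k₁) - y * (S - k₁))
      = (S - k₁) * (1 - y) * y * ((S - k₁) * (1 + y) - d) := by ring
  rw [key]
  have hSk' : 0 ≤ S - k₁ := by linarith
  exact mul_nonneg (mul_nonneg (mul_nonneg hSk' (by linarith)) hy0) (by nlinarith [mul_nonneg hy0 hSk'])

/-- **right endpoint `s = S − yk₁`** (the top-affordability corner `yh = S`):
`Φ(S − yk₁) = (1−y)·[(S−k₁)(k₁(2−y) − A₀) − (k₁ − S(1−w))·(yS − y²k₁ + (1−y)d)]` with `d = S + A₀ − 2k₁`; the bracket is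
bounded below by the same expression with `k₁ − Sg ≥ k₁ − S(1−w)` (`w ≤ 1−g`), which is decreasing in `A₀ ∈ [0, k₁]` and at
`A₀ = k₁` equals `(S−k₁)(Sg − yk₁) − (k₁−Sg)yk₁(1−y) ≥ g(S−k₁)² − gk₁² ≥ 0` (`y ≤ g`, `2k₁ ≤ S`). [this work] -/
theorem btwinE_light_end_top (y g S d w A₀ k₁ : ℝ) (hy0 : 0 ≤ y) (hyg : y ≤ g) (hg1 : g ≤ 1) (hk0 : 0 ≤ k₁) (h2k : 2 * k₁ ≤ S)
    (hA0 : 0 ≤ A₀) (hA : A₀ ≤ k₁) (hd : d = S + A₀ - 2 * k₁) (hw1 : w ≤ 1 - g) (hδ : S * (1 - w) ≤ k₁) :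
    0 ≤ (S - k₁) * (1 - y) * ((S - y * k₁) * (1 + y) - y * d)
        - w * (y * (S - y * k₁) + (1 - y) * d) * ((S - y * k₁) - y * (S - k₁)) := by
  have hy1 : y ≤ 1 := le_trans hyg hg1
  have hS0 : 0 ≤ S := by linarith
  have hbr : 0 ≤ y * S - y ^ 2 * k₁ + (1 - y) * d := by
    rw [hd]
    nlinarith [mul_nonneg hy0 hk0, mul_nonneg hy0 (show (0:ℝ) ≤ S - 2 * k₁ by linarith), mul_nonneg hy0 hA0,
      mul_nonneg (mul_nonneg hy0 (show (0:ℝ) ≤ 1 - y by linarith)) hk0]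
  have key : (S - k₁) * (1 - y) * ((S - y * k₁) * (1 + y) - y * d)
        - w * (y * (S - y * k₁) + (1 - y) * d) * ((S - y * k₁) - y * (S - k₁))
      = (1 - y) * ((S - k₁) * (k₁ * (2 - y) - A₀) - (k₁ - S * (1 - w)) * (y * S - y ^ 2 * k₁ + (1 - y) * d)) := by
    rw [hd]; ring
  rw [key]
  refine mul_nonneg (by linarith) ?_
  -- replace δ = k₁ - S(1-w) by the larger k₁ - Sg (bracket ≥ 0)
  have hδle : k₁ - S * (1 - w) ≤ k₁ - S * g := by nlinarith
  have h1 : (k₁ - S * (1 - w)) * (y * S - y ^ 2 * k₁ + (1 - y) * d)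
      ≤ (k₁ - S * g) * (y * S - y ^ 2 * k₁ + (1 - y) * d) :=
    mul_le_mul_of_nonneg_right hδle hbr
  -- E(A₀) := (S-k₁)(k₁(2-y) - A₀) - (k₁ - Sg)(yS - y²k₁ + (1-y)d) ≥ 0
  have hSk : 0 ≤ S - k₁ := by linarith
  have hδ0 : 0 ≤ k₁ - S * g := le_trans (by linarith) hδle
  have hE : 0 ≤ (S - k₁) * (k₁ * (2 - y) - A₀) - (k₁ - S * g) * (y * S - y ^ 2 * k₁ + (1 - y) * d) := by
    rw [hd]
    -- E(A₀) = E(k₁) + (k₁ - A₀)((S-k₁) + (k₁-Sg)(1-y)), E(k₁) = (S-k₁)(Sg - yk₁) - (k₁-Sg) y k₁ (1-y)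
    have e : (S - k₁) * (k₁ * (2 - y) - A₀) - (k₁ - S * g) * (y * S - y ^ 2 * k₁ + (1 - y) * (S + A₀ - 2 * k₁))
        = (k₁ - A₀) * ((S - k₁) + (k₁ - S * g) * (1 - y))
          + ((S - k₁) * (S * g - y * k₁) - (k₁ - S * g) * (y * k₁ * (1 - y))) := by ring
    rw [e]
    have t1 : 0 ≤ (k₁ - A₀) * ((S - k₁) + (k₁ - S * g) * (1 - y)) :=
      mul_nonneg (by linarith) (add_nonneg hSk (mul_nonneg hδ0 (by linarith)))
    -- E(k₁) ≥ g (S-k₁)^2 - g k₁^2 ≥ 0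
    have t2a : g * (S - k₁) ≤ S * g - y * k₁ := by nlinarith [mul_nonneg (sub_nonneg.2 hyg) hk0]
    have t2b : (k₁ - S * g) * (y * k₁ * (1 - y)) ≤ g * k₁ ^ 2 := by
      have : y * k₁ * (1 - y) ≤ g * k₁ := by nlinarith [mul_nonneg hy0 hk0, mul_nonneg (mul_nonneg hy0 hy0) hk0]
      have : (k₁ - S * g) * (y * k₁ * (1 - y)) ≤ (k₁ - S * g) * (g * k₁) := mul_le_mul_of_nonneg_left this hδ0
      nlinarith [mul_nonneg (mul_nonneg hS0 (le_trans hy0 hyg)) (mul_nonneg (le_trans hy0 hyg) hk0)]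
    have t2c : g * k₁ ^ 2 ≤ g * (S - k₁) ^ 2 := by
      refine mul_le_mul_of_nonneg_left ?_ (le_trans hy0 hyg)
      nlinarith
    have t2 : 0 ≤ (S - k₁) * (S * g - y * k₁) - (k₁ - S * g) * (y * k₁ * (1 - y)) := by
      nlinarith [mul_le_mul_of_nonneg_left t2a hSk]
    exact add_nonneg t1 t2
  linarith

end LawDec

end Quant

end Summit.CriticalPhenomena.PercolationContinuityZ3.Theorems
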